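import Mathlib
import Literature.MathematicalPhysics.QuantumFieldTheory.Balaban1983to89.B13ExpansionOrder

/-!
# Beta / Insertion331 — BINDER-OWNERS row D4, co-owner road P2′: the t·g_k-INSERTION of [Balaban1988Convergent] (3.31)
# p. 273 has COUPLING-FREE coefficients — the «O(1) cubic insertion» behind «B₀ replaced by O(p₀³(g_k))» (p. 278) — and the
# curly-bracket insertion costs ONE field power at an ABSOLUTE radius; abstract kernel form
# (β sub-cell, unit `b2b-balaban-beta-d4-p2`, generation 1; NODE V (leaves V.1–V.4) of `HOME/beta/skeletons/D4-b2b-balaban-beta-d4-p2.md`)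

HONEST FRAMING (page 1 of everything the β sub-cell writes): discharging `BetaPertH` makes Bałaban's UV stability
UNCONDITIONAL — a real constructive-QFT result; it is NOT the continuum limit and NOT the Clay problem.  HONEST DEPENDENCY
(cell reorg 2026-08-19, verbatim): «continuum YM on T⁴ ⇐ BetaPertH ∧ nine spine estimates (0/9 proved); BetaPertH ⇐ (D1) ∧
(D4) ∧ CAP+tail; G-an2-4 gates asym, D1 and NE2/3/4.»  THIS MODULE INSTANTIATES NO BINDER AND ASSERTS NOTHING ABOUT
BAŁABAN'S TERMS: it is one-variable complex analysis (iterated divided slopes, the order-n Schwarz lemma of the tree's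
`B11SchwarzRemainder`, Cauchy's estimate for the derivative), applied along complex slices of maps between Banach spaces
(`B13ExpansionOrder.slice`, `BeginsAt`); every theorem is proved from Mathlib and those UNMODIFIED tree modules.

ABSOLUTE RULE (cell charter, verbatim): "No internally-minted statement may enter as a cited fact. Every hypothesis is
either kernel-proved in this package or a verbatim quotation of a PUBLISHED theorem with page reference. The manuscript(s)
under audit are NOT citable for their own disputed steps — they are the thing under adjudication; programme-internal
(2001/route/tribunal) claims are never citable."  Nothing is cited as a fact here.

## The printed text and what is typed

[III] = [Balaban1988Convergent], CMP **119**, p. 273 [PDF 31] (render p031 READ AS AN IMAGE), verbatim: *«They can be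
expressed as inner products of functional derivatives of some functions of tg_kCA, with the field CA. This is obvious for
all terms in the effective action, as displayed in the formula (2.12) [I], maybe with the exception of the terms divided
by (tg_k)². These we expand up to the second order with respect to tg_kCA. We use the fact that the lower-order terms
vanish, and we represent the remainders by quadratic forms in A, as in (6.42) [I]. The coefficients are functions of
tg_kCA, and the differentiation with respect to tg_k yields such an inner product. Thus the derivatives in the expectation
value can be written as ⟨𝐕′_k(tg_k, A), CA⟩ = Σ_{b∈Λ^{(k)}_{k+1}} tr 𝐕′_k(tg_k, A, b)(CA)(b), (3.31)»*; [I] =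
[Balaban1987RG1] (2.12) p. 268: the «terms divided by g_k²» are `(1/g_k²)·V(g_k·Y)`-shaped with `V` «of at least third
order» ((2.8) p. 266 «Denoting terms of at least third order in H₁B′ by V(H₁B′)»; `B13ExpansionOrder.BeginsAt V 3`);
the cell's located failure of the linear road, `BETA/AN4.md` §4 (P1): «∂_{g_k}[(1/g_k²)V(g_kY)] = (1/g_k³)[(w∂_w − 2)V](w)|
_{w = g_kY} … leaves a CUBIC bounded polynomial in B with coefficients … bounded by Cauchy … by an ABSOLUTE constant».

TYPED (one complex variable `s` = the coupling `tg_k` along the slice `s ↦ V(s·Y)`, `Y = CA` fixed; then Banach slices):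
* §1 for `φ : ℂ → F` complex-differentiable on `|s| < ρ` with `‖φ‖ ≤ M` and `φ = O(s³)` (`OrderGe φ 3`): the
  coupling-scaled term `P φ s := s⁻²φ(s)` IS `s · tail φ 3 s` (`tail` = iterated divided slope of `B11SchwarzRemainder`;
  `P_eq_inv_sq_smul`), is complex-differentiable on the whole disc INCLUDING `s = 0` (`differentiableOn_P`), and obeys
  `‖P φ s‖ ≤ M‖s‖/ρ³` (`norm_P_le`); its derivative — [III]'s insertion `⟨𝐕′(s, A), CA⟩` for this term — obeys
  **`‖deriv (P φ) s‖ ≤ 2M/ρ³` for `|s| < ρ/2`, INDEPENDENT OF s** (`norm_deriv_P_le`) — AN4 (P1)'s «ABSOLUTE constant»,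
  here by Cauchy's estimate on the circle of radius ρ/2 (no third-order Taylor algebra needed).
* §2 along slices of `V : E → F` (`DifferentiableOn ℂ V (ball 0 R)`, `‖V‖ ≤ M`, `BeginsAt V 3`): with `ρ = R/‖Y‖`,
  **`‖deriv (P (slice V Y)) s‖ ≤ (2M/R³)·‖Y‖³` for `‖s‖·‖Y‖ < R/2`** (`norm_insertion_le`) — the CUBIC sup-bound of the
  insertion on the field box: with [III]'s cut-off `‖Y‖ ≤ ‖C‖·r_k`, `r_k = A₁(log g_k⁻²)^{p₀}`, this is «O(p₀³(g_k))»
  (p. 278 l. 16) with the constant `2M‖C‖³/R³` (road P2′'s `c_I`, `CutoffVariant316.budget`).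
* §3 `norm_deriv_le_of_bound` — the generic Cauchy estimate used twice: `f` differentiable on `|s| < σ`, `‖f‖ ≤ B` ⟹
  `‖f′(s)‖ ≤ 2B/σ` for `|s| < σ/2`; applied (V.3) to the curly-bracket slice `s ↦ 𝐄_k((exp isW)·U) − 𝐄_k(U)` with
  `σ = α₀/‖W‖` ([I]'s ABSOLUTE background radius α₀ and (I.1.18)'s `E₀`): `‖insertion‖ ≤ 4E₀‖W‖/α₀` — ONE power of the
  field, road P2′'s `c_E·r` term; with [III]'s radius α_{0,j} ∝ g_j instead, the same line gives `4E₀‖W‖/α_{0,j}` — no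
  g to spare (cell SMALLNESS S-B14.36 (X14), GAPS G-adv5-21 (b)).
NOT CLAIMED: which of Bałaban's seven (2.12)-terms satisfy the hypotheses (the census modules `B13PkScaling`,
`B13ExpansionOrder`, `PkDecoupledTerms` hold that bookkeeping); anything of `BetaPertH`; NOT continuum, NOT Clay.
-/

namespace Summit.QuantumFields.BalabanUV.Beta.Insertion331

open Metric Set Filter Topology
open Literature.MathematicalPhysics.QuantumFieldTheory.Balaban1983to89.B11SchwarzRemainder
open Literature.MathematicalPhysics.QuantumFieldTheory.Balaban1983to89.B13ExpansionOrder

noncomputable section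

variable {F : Type*} [NormedAddCommGroup F] [NormedSpace ℂ F] [CompleteSpace F]

/-! ## §3 (stated first, used twice) Cauchy's estimate at half radius -/

omit [CompleteSpace F] in
/-- **Cauchy at half radius**: `f` complex-differentiable on `|s| < σ` with `‖f‖ ≤ B` there ⟹ `‖f′(s)‖ ≤ 2B/σ` for
`|s| < σ/2` (the circle `|z − s| = σ/2` lies in the disc). -/
theorem norm_deriv_le_of_bound {f : ℂ → F} {σ B : ℝ} (hσ : 0 < σ) (hf : DifferentiableOn ℂ f (ball 0 σ))
    (hB : ∀ z ∈ ball (0 : ℂ) σ, ‖f z‖ ≤ B) {s : ℂ} (hs : ‖s‖ < σ / 2) : ‖deriv f s‖ ≤ 2 * B / σ := by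
  have hsub : closedBall s (σ / 2) ⊆ ball (0 : ℂ) σ := by
    intro z hz
    rw [mem_closedBall, dist_eq_norm] at hz
    rw [mem_ball_zero_iff]
    calc ‖z‖ = ‖(z - s) + s‖ := by ring_nf
      _ ≤ ‖z - s‖ + ‖s‖ := norm_add_le _ _
      _ < σ / 2 + σ / 2 := by linarith
      _ = σ := by ring
  have hd : DiffContOnCl ℂ f (ball s (σ / 2)) := by
    apply DifferentiableOn.diffContOnCl
    rw [closure_ball s (by linarith : σ / 2 ≠ 0)]
    exact hf.mono hsub
  have hC : ∀ z ∈ sphere s (σ / 2), ‖f z‖ ≤ B := fun z hz =>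
    hB z (hsub (sphere_subset_closedBall hz))
  have h := Complex.norm_deriv_le_of_forall_mem_sphere_norm_le (by linarith : 0 < σ / 2) hd hC
  calc ‖deriv f s‖ ≤ B / (σ / 2) := h
    _ = 2 * B / σ := by field_simp

/-! ## §1 The coupling-scaled cubic term `P(s) = s⁻²φ(s)` and its s-derivative (the insertion) -/

/-- The coupling-scaled interaction along a slice: `P φ s := s · tail φ 3 s`, which equals `s⁻²·φ(s)` for `s ≠ 0` when
`φ = O(s³)` (`P_eq_inv_sq_smul`) and is differentiable at `s = 0` as well. -/
def P (φ : ℂ → F) (s : ℂ) : F := s • tail φ 3 s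

variable {φ : ℂ → F} {ρ M : ℝ}

/-- `φ(s) = s³ · tail φ 3 s` (order-3 factorisation, `B11SchwarzRemainder.eq_pow_smul_tail`). -/
theorem eq_cube_smul_tail (hρ : 0 < ρ) (hφ : DifferentiableOn ℂ φ (ball 0 ρ))
    (hM : ∀ s ∈ ball (0 : ℂ) ρ, ‖φ s‖ ≤ M) (h3 : OrderGe φ 3) (s : ℂ) : φ s = s ^ 3 • tail φ 3 s :=
  eq_pow_smul_tail hρ hφ hM h3 s

/-- **`P(s) = s⁻²·φ(s)` for `s ≠ 0`** — `P` IS the «term divided by (tg_k)²» of [III] p. 273 along the slice. -/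
theorem P_eq_inv_sq_smul (hρ : 0 < ρ) (hφ : DifferentiableOn ℂ φ (ball 0 ρ))
    (hM : ∀ s ∈ ball (0 : ℂ) ρ, ‖φ s‖ ≤ M) (h3 : OrderGe φ 3) {s : ℂ} (hs : s ≠ 0) :
    P φ s = (s ^ 2)⁻¹ • φ s := by
  unfold P
  rw [eq_cube_smul_tail hρ hφ hM h3 s, smul_smul]
  congr 1
  field_simp

/-- `P` is complex-differentiable on the whole disc (the singularity at `s = 0` is removable: `tail φ 3` is
differentiable there, `differentiableOn_tail`). -/
theorem differentiableOn_P (hρ : 0 < ρ) (hφ : DifferentiableOn ℂ φ (ball 0 ρ)) : DifferentiableOn ℂ (P φ) (ball 0 ρ) :=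
  differentiableOn_id.smul (differentiableOn_tail hρ hφ 3)

/-- **`‖P(s)‖ ≤ M‖s‖/ρ³` on the disc** (order-3 Schwarz: `‖tail φ 3‖ ≤ M/ρ³`, `tail_vanish_and_bound`). -/
theorem norm_P_le (hρ : 0 < ρ) (hφ : DifferentiableOn ℂ φ (ball 0 ρ)) (hM : ∀ s ∈ ball (0 : ℂ) ρ, ‖φ s‖ ≤ M)
    (h3 : OrderGe φ 3) {s : ℂ} (hs : s ∈ ball (0 : ℂ) ρ) : ‖P φ s‖ ≤ M * ‖s‖ / ρ ^ 3 := by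
  unfold P
  rw [norm_smul]
  have h := (tail_vanish_and_bound hρ 3 M φ hφ hM h3).2 s hs
  calc ‖s‖ * ‖tail φ 3 s‖ ≤ ‖s‖ * (M / ρ ^ 3) := mul_le_mul_of_nonneg_left h (norm_nonneg _)
    _ = M * ‖s‖ / ρ ^ 3 := by ring

/-- **V.1/V.2 — THE INSERTION HAS A COUPLING-FREE BOUND**: `‖(d/ds)P(s)‖ ≤ 2M/ρ³` for `|s| < ρ/2`.  (AN4 (P1): «third
derivatives, bounded by Cauchy on the same strip by an ABSOLUTE constant — no ε₁»; here in one line from §3.) -/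
theorem norm_deriv_P_le (hρ : 0 < ρ) (hφ : DifferentiableOn ℂ φ (ball 0 ρ)) (hM : ∀ s ∈ ball (0 : ℂ) ρ, ‖φ s‖ ≤ M)
    (h3 : OrderGe φ 3) {s : ℂ} (hs : ‖s‖ < ρ / 2) : ‖deriv (P φ) s‖ ≤ 2 * M / ρ ^ 3 := by
  have hB : ∀ z ∈ ball (0 : ℂ) ρ, ‖P φ z‖ ≤ M / ρ ^ 2 := by
    intro z hz
    have hzρ : ‖z‖ < ρ := mem_ball_zero_iff.1 hz
    have hM0 : 0 ≤ M := le_trans (norm_nonneg _) (hM 0 (mem_ball_self hρ))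
    calc ‖P φ z‖ ≤ M * ‖z‖ / ρ ^ 3 := norm_P_le hρ hφ hM h3 hz
      _ ≤ M * ρ / ρ ^ 3 := by gcongr
      _ = M / ρ ^ 2 := by field_simp
  have h := norm_deriv_le_of_bound hρ (differentiableOn_P hρ hφ) hB hs
  calc ‖deriv (P φ) s‖ ≤ 2 * (M / ρ ^ 2) / ρ := h
    _ = 2 * M / ρ ^ 3 := by field_simp

/-- The insertion IS the s-derivative of the scaled term: for `s ≠ 0` in the half disc,
`HasDerivAt (s ↦ s⁻²·φ(s)) (deriv (P φ) s) s`. -/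
theorem hasDerivAt_inv_sq_smul (hρ : 0 < ρ) (hφ : DifferentiableOn ℂ φ (ball 0 ρ))
    (hM : ∀ s ∈ ball (0 : ℂ) ρ, ‖φ s‖ ≤ M) (h3 : OrderGe φ 3) {s : ℂ} (hs : s ∈ ball (0 : ℂ) ρ) (hs0 : s ≠ 0) :
    HasDerivAt (fun z : ℂ => (z ^ 2)⁻¹ • φ z) (deriv (P φ) s) s := by
  have hPd : HasDerivAt (P φ) (deriv (P φ) s) s :=
    ((differentiableOn_P hρ hφ).differentiableAt (isOpen_ball.mem_nhds hs)).hasDerivAt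
  refine hPd.congr_of_eventuallyEq ?_
  filter_upwards [isOpen_ne.mem_nhds hs0] with z hz
  exact (P_eq_inv_sq_smul hρ hφ hM h3 hz).symm

/-! ## §2 Along slices of a Banach-space map: the cubic field bound -/

variable {E : Type*} [NormedAddCommGroup E] [NormedSpace ℂ E]

/-- **V.2 — THE CUBIC SUP-BOUND OF THE INSERTION ON THE FIELD BOX.**  `V : E → F` complex-differentiable on `ball 0 R`,
`‖V‖ ≤ M` there, «beginning with third order terms» (`BeginsAt V 3`); along the slice `s ↦ V(s·Y)` (coupling s, field
`Y = CA ≠ 0`): `‖(d/ds)[s⁻²V(sY)]‖ ≤ (2M/R³)·‖Y‖³` whenever `‖s‖·‖Y‖ < R/2`.  With `‖Y‖ ≤ ‖C‖r_k` on [III]'s cut-off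
box this is `≤ (2M‖C‖³/R³)·r_k³` — «(2.42) with the constant B₀ replaced by O(p₀³(g_k))» ([III] p. 278 l. 16),
constant explicit. -/
theorem norm_insertion_le {V : E → F} {R M : ℝ} (hR : 0 < R) (hV : DifferentiableOn ℂ V (ball 0 R))
    (hM : ∀ z ∈ ball (0 : E) R, ‖V z‖ ≤ M) (h3 : BeginsAt V 3) {Y : E} (hY : Y ≠ 0) {s : ℂ}
    (hs : ‖s‖ * ‖Y‖ < R / 2) : ‖deriv (P (slice V Y)) s‖ ≤ 2 * M / R ^ 3 * ‖Y‖ ^ 3 := by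
  have hYpos : 0 < ‖Y‖ := norm_pos_iff.2 hY
  have hρ : 0 < R / ‖Y‖ := div_pos hR hYpos
  have hs' : ‖s‖ < R / ‖Y‖ / 2 := by
    rw [div_div, lt_div_iff₀ (by positivity)]; linarith
  have h := norm_deriv_P_le hρ (differentiableOn_slice hV hY) (norm_slice_le hM hY) (h3 Y) hs'
  calc ‖deriv (P (slice V Y)) s‖ ≤ 2 * M / (R / ‖Y‖) ^ 3 := h
    _ = 2 * M / R ^ 3 * ‖Y‖ ^ 3 := by field_simp

omit [CompleteSpace F] in
/-- The degenerate direction `Y = 0`: the slice is the constant `V 0 = 0` and the insertion vanishes. -/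
theorem insertion_zero_dir {V : E → F} (h3 : BeginsAt V 3) (s : ℂ) : deriv (P (slice V (0 : E))) s = 0 := by
  have h0 : V 0 = 0 := eq_zero_of_beginsAt_succ h3
  have hsl : slice V (0 : E) = 0 := by funext t; simp [slice, h0]
  have hP : P (slice V (0 : E)) = fun _ => 0 := by
    funext z
    unfold P
    rw [hsl, tail_zero_fun]
    simp
  rw [hP, deriv_const]

/-! ## §3 applied — V.3: the curly-bracket insertion costs ONE field power at an ABSOLUTE radius -/

omit [CompleteSpace F] in
/-- **V.3 — the old-terms («curly bracket») insertion.**  Along the slice `f(s) = 𝐄((exp isW)·U) − 𝐄(U)` of an OLD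
effective-action term: if `f` is complex-differentiable on `|s| < α₀/‖W‖` (the complexified shift stays in [I]'s ball
of ABSOLUTE radius α₀) and `‖f‖ ≤ 2E₀` there ((I.1.18) twice), then the insertion `f′(s)` obeys
`‖f′(s)‖ ≤ 4E₀‖W‖/α₀` for `‖s‖·‖W‖ < α₀/2` — ONE power of the field `‖W‖ ≤ ‖C‖r_k(1 + L_D̃)`, coefficient `E₀/α₀`
coupling-free (road P2′'s `c_E`).  Stated for any `E₀, α₀ > 0`, `W ≠ 0`. -/
theorem norm_curly_insertion_le {f : ℂ → F} {E₀ α₀ nW : ℝ} (hα : 0 < α₀) (hW : 0 < nW)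
    (hf : DifferentiableOn ℂ f (ball 0 (α₀ / nW))) (hB : ∀ z ∈ ball (0 : ℂ) (α₀ / nW), ‖f z‖ ≤ 2 * E₀) {s : ℂ}
    (hs : ‖s‖ * nW < α₀ / 2) : ‖deriv f s‖ ≤ 4 * E₀ * nW / α₀ := by
  have hσ : 0 < α₀ / nW := div_pos hα hW
  have hs' : ‖s‖ < α₀ / nW / 2 := by
    rw [div_div, lt_div_iff₀ (by positivity)]; linarith
  have h := norm_deriv_le_of_bound hσ hf hB hs'
  calc ‖deriv f s‖ ≤ 2 * (2 * E₀) / (α₀ / nW) := h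
    _ = 4 * E₀ * nW / α₀ := by field_simp; ring

end

end Summit.QuantumFields.BalabanUV.Beta.Insertion331
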